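import Literature.Geometry.Manifold.SimplexIntegral
import Mathlib.LinearAlgebra.FiniteDimensional.Lemmas
import HarnessLib

/-!
# The integral of a form over a degenerate affine reparametrisation of a smooth simplex vanishes

Topic `Literature/Geometry/Manifold`. A **degenerate affine reparametrisation** of a singular
`p`-simplex `σ` is `σ ∘ [e_{u₀}, …, e_{u_k}] : Δᵏ → M` for a vertex-label map
`u : Fin (k+1) → Fin (p+1)` that is NOT injective (a repeated vertex): the affine simplex
`[e_{u₀}, …, e_{u_k}]` spans an affine subspace of dimension `≤ k - 1`, so the `k` tangent vectors of
the cube parametrisation of `σ ∘ [e_u]` at every point are linearly dependent and every `k`-form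
pulled back along it vanishes identically. Hence (`formIntegral_compose_vertex_eq_zero`)

`∫_{σ ∘ [e_{u₀}, …, e_{u_k}]} η = 0`   for `σ` smooth, `u` non-injective, `η` any `k`-form.

This is the analytic input "integration cochains vanish on degenerate simplices" of the comparison
of the de Rham (wedge) product with the Alexander–Whitney cup product through the Eilenberg–Zilber
shuffle map (Eilenberg–Mac Lane 1953; Bredon (1993), VI §4; the hypotheses `ha`, `hb` of
`…SingularHomology.cochainEval_crossCochain_ezMap`). Ingredients: the cube parametrisation
(`…SingularSimplex.cubeMap`, `formIntegrand`, `formIntegral` of `…Manifold.SimplexIntegral`), the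
chain rule within the cube (uniqueness of derivatives is only needed on the cube), and
`AlternatingMap.map_linearDependent`.

Everything is proved; no named facts.

## References

* G. E. Bredon, *Topology and Geometry*, GTM 139 (1993), VI §4. [Bredon1993]
* J. M. Lee, *Introduction to Smooth Manifolds*, 2nd ed. (2013), Ch. 18 p. 481. [LeeSmoothManifolds2013]
-/

noncomputable section

-- `TangentSpace 𝓘(ℝ, ℝᵏ) t = ℝᵏ` and the instance paths on it are used up to unfolding (as in the
-- tree's `SimplexIntegral`)
set_option backward.isDefEq.respectTransparency false

open scoped Manifold ContDiff Topology
open Set Filter MeasureTheory Module Literature.Geometry.Manifold Literature.Geometry.Kaehler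

universe u v

namespace Literature.AlgebraicTopology.SingularHomology.SingularSimplex

variable {E : Type u} [NormedAddCommGroup E] [NormedSpace ℝ E]
  {H : Type*} [TopologicalSpace H] {I : ModelWithCorners ℝ E H}
  {M : Type u} [TopologicalSpace M] [ChartedSpace H M]
  {F : Type v} [NormedAddCommGroup F] [NormedSpace ℝ F] {k p : ℕ}

/-! ### The linear vertex-label map and its rank -/

/-- The linear extension `x ↦ ∑ⱼ xⱼ e_{uⱼ} : ℝᵏ⁺¹ → ℝᵖ⁺¹` of the affine simplex `[e_{u₀}, …, e_{u_k}]`. [folklore] -/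
def vertexLabelCLM (u : Fin (k + 1) → Fin (p + 1)) : (Fin (k + 1) → ℝ) →L[ℝ] (Fin (p + 1) → ℝ) :=
  ∑ j, (ContinuousLinearMap.proj j).smulRight (Pi.single (u j) (1 : ℝ))

/-- The vertex-label map on a vector. [folklore] -/
theorem vertexLabelCLM_apply (u : Fin (k + 1) → Fin (p + 1)) (x : Fin (k + 1) → ℝ) :
    vertexLabelCLM u x = ∑ j, x j • (Pi.single (u j) (1 : ℝ) : Fin (p + 1) → ℝ) := by
  simp [vertexLabelCLM]

/-- On the standard simplex the vertex-label map is the affine simplex on the vertices `e_{uⱼ}`. [folklore] -/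
theorem vertexLabelCLM_eq_sum_vertex (u : Fin (k + 1) → Fin (p + 1)) (x : Fin (k + 1) → ℝ) :
    vertexLabelCLM u x = ∑ j, x j • ((stdSimplex.vertex (S := ℝ) (u j) : stdSimplex ℝ (Fin (p + 1))) : Fin (p + 1) → ℝ) := by
  rw [vertexLabelCLM_apply]
  rfl

/-- The difference subspace `span {e_{uⱼ} - e_{u₀}}` of the affine simplex `[e_u]`. [folklore] -/
def vertexDiffSpan (u : Fin (k + 1) → Fin (p + 1)) : Submodule ℝ (Fin (p + 1) → ℝ) :=
  Submodule.span ℝ (Set.range fun j : Fin (k + 1) ↦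
    (Pi.single (u j) (1 : ℝ) : Fin (p + 1) → ℝ) - Pi.single (u 0) (1 : ℝ))

/-- A vector with coordinate sum `0` is mapped into the difference subspace. [folklore] -/
theorem vertexLabelCLM_mem_vertexDiffSpan (u : Fin (k + 1) → Fin (p + 1)) {v : Fin (k + 1) → ℝ}
    (hv : ∑ j, v j = 0) : vertexLabelCLM u v ∈ vertexDiffSpan u := by
  have h : vertexLabelCLM u v = ∑ j, v j • ((Pi.single (u j) (1 : ℝ) : Fin (p + 1) → ℝ) - Pi.single (u 0) (1 : ℝ)) := by
    rw [vertexLabelCLM_apply]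
    simp only [smul_sub, Finset.sum_sub_distrib, ← Finset.sum_smul, hv, zero_smul, sub_zero]
  rw [h]
  exact Submodule.sum_mem _ fun j _ ↦ Submodule.smul_mem _ _ (Submodule.subset_span ⟨j, rfl⟩)

/-- **For a non-injective label map the difference subspace has dimension `≤ k - 1`** (at most `k`
distinct vertices). [folklore] -/
theorem finrank_vertexDiffSpan_le {u : Fin (k + 1) → Fin (p + 1)} (hu : ¬Function.Injective u) :
    finrank ℝ (vertexDiffSpan u) ≤ k - 1 := by
  classical
  set f : Fin (k + 1) → (Fin (p + 1) → ℝ) := fun j ↦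
    (Pi.single (u j) (1 : ℝ) : Fin (p + 1) → ℝ) - Pi.single (u 0) (1 : ℝ) with hf
  have h0 : (0 : Fin (p + 1) → ℝ) ∈ Finset.univ.image f := Finset.mem_image.mpr ⟨0, Finset.mem_univ _, by simp [hf]⟩
  have hspan : vertexDiffSpan u = Submodule.span ℝ ((Finset.univ.image f).erase 0 : Finset (Fin (p + 1) → ℝ)) := by
    rw [vertexDiffSpan, ← hf, ← Set.image_univ, ← Finset.coe_univ, ← Finset.coe_image]
    conv_lhs => rw [← Finset.insert_erase h0, Finset.coe_insert, Submodule.span_insert_zero]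
  -- the image has at most `k` elements (a repeated value) and contains `0`
  have hcard : (Finset.univ.image f).card ≤ k := by
    have hlt : (Finset.univ.image f).card < (Finset.univ : Finset (Fin (k + 1))).card := by
      refine lt_of_le_of_ne Finset.card_image_le fun heq ↦ hu ?_
      have hinj : Set.InjOn f (Finset.univ : Finset (Fin (k + 1))) := Finset.card_image_iff.mp heq
      intro i j hij
      exact hinj (Finset.mem_univ i) (Finset.mem_univ j) (by simp only [hf, hij])
    simpa using hlt
  calc finrank ℝ (vertexDiffSpan u)
      ≤ ((Finset.univ.image f).erase 0).card := by rw [hspan]; exact finrank_span_finset_le_card _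
    _ = (Finset.univ.image f).card - 1 := Finset.card_erase_of_mem h0
    _ ≤ k - 1 := by omega

/-- **`k` vectors in the image of the difference subspace of a non-injective label map, pushed
through any linear map, are linearly dependent.** [folklore] -/
theorem not_linearIndependent_of_mem_vertexDiffSpan {u : Fin (k + 1) → Fin (p + 1)} (hu : ¬Function.Injective u)
    {W : Type*} [AddCommGroup W] [Module ℝ W] (A : (Fin (p + 1) → ℝ) →ₗ[ℝ] W) {g : Fin k → Fin (p + 1) → ℝ}
    (hg : ∀ i, g i ∈ vertexDiffSpan u) : ¬LinearIndependent ℝ (fun i ↦ A (g i)) := by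
  intro hli
  have hk : 0 < k := by
    rcases Nat.eq_zero_or_pos k with rfl | h
    · exact absurd (fun i j _ ↦ Subsingleton.elim (α := Fin 1) i j) hu
    · exact h
  have hli' : LinearIndependent ℝ g := LinearIndependent.of_comp A (by exact hli)
  let g' : Fin k → vertexDiffSpan u := fun i ↦ ⟨g i, hg i⟩
  have hli'' : LinearIndependent ℝ g' := LinearIndependent.of_comp (vertexDiffSpan u).subtype (by exact hli')
  have h1 := hli''.fintype_card_le_finrank
  have h2 := finrank_vertexDiffSpan_le hu
  rw [Fintype.card_fin] at h1
  omega

/-! ### The cube parametrisation of an affine reparametrisation -/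

/-- On the cube, the cube parametrisation of `σ ∘ [e_u]` factors through the vertex-label map:
`(σ ∘ [e_u]).cubeMap = σ̃ ∘ L_u ∘ c_k`. [folklore] -/
theorem cubeMap_compose_vertex_eqOn (σ : SingularSimplex M p) (u : Fin (k + 1) → Fin (p + 1)) :
    EqOn (σ.compose fun j ↦ stdSimplex.vertex (u j)).cubeMap
      (σ.bext ∘ vertexLabelCLM u ∘ Literature.Geometry.Manifold.cubeToSimplex k) (unitCube k) := fun t ht ↦ by
  rw [cubeMap_apply, bext_compose_apply_of_mem _ _ (cubeToSimplex_mem_stdSimplex ht), Function.comp_apply,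
    Function.comp_apply, vertexLabelCLM_eq_sum_vertex]

/-- The vertex-label map sends the standard `k`-simplex into the standard `p`-simplex. [folklore] -/
theorem vertexLabelCLM_mem_stdSimplex (u : Fin (k + 1) → Fin (p + 1)) {x : Fin (k + 1) → ℝ}
    (hx : x ∈ stdSimplex ℝ (Fin (k + 1))) : vertexLabelCLM u x ∈ stdSimplex ℝ (Fin (p + 1)) := by
  rw [vertexLabelCLM_eq_sum_vertex]
  exact (StdSimplex.affComb (fun j ↦ stdSimplex.vertex (u j)) ⟨x, hx⟩).2

/-- The coordinate sum of a tangent vector of the collapse vanishes: `∑ⱼ (Dc_k(t) v)ⱼ = 0` (the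
collapse maps into the hyperplane `∑ = 1`). [folklore] -/
theorem sum_fderiv_cubeToSimplex_apply (t v : Fin k → ℝ) : ∑ j, fderiv ℝ (Literature.Geometry.Manifold.cubeToSimplex k) t v j = 0 := by
  have hc : ∀ s, (∑ j, Literature.Geometry.Manifold.cubeToSimplex k s j) = 1 := sum_cubeToSimplex k
  -- `∑ⱼ cⱼ` is the constant `1`, so its derivative, `v ↦ ∑ⱼ (Dc v)ⱼ`, vanishes
  have hd : HasFDerivAt (fun s : Fin k → ℝ ↦ ∑ j, Literature.Geometry.Manifold.cubeToSimplex k s j)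
      (∑ j, (ContinuousLinearMap.proj (R := ℝ) (φ := fun _ : Fin (k + 1) ↦ ℝ) j).comp (fderiv ℝ (Literature.Geometry.Manifold.cubeToSimplex k) t)) t := by
    refine HasFDerivAt.fun_sum fun j _ ↦ ?_
    exact (ContinuousLinearMap.proj (R := ℝ) (φ := fun _ : Fin (k + 1) ↦ ℝ) j).hasFDerivAt.comp t
      (differentiable_cubeToSimplex k t).hasFDerivAt
  have hconst : HasFDerivAt (fun _ : Fin k → ℝ ↦ (1 : ℝ)) (0 : (Fin k → ℝ) →L[ℝ] ℝ) t := hasFDerivAt_const 1 t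
  have heq : (fun s : Fin k → ℝ ↦ ∑ j, Literature.Geometry.Manifold.cubeToSimplex k s j) = fun _ ↦ (1 : ℝ) := funext hc
  rw [heq] at hd
  have := congrArg (fun L : (Fin k → ℝ) →L[ℝ] ℝ ↦ L v) (hd.unique hconst)
  simpa using this

/-- **The integrand of `∫_{σ ∘ [e_u]} η` vanishes identically on the cube** when `u` is not
injective: the `k` tangent vectors of the cube parametrisation are linearly dependent. [folklore] -/
theorem formIntegrand_compose_vertex_eq_zero {σ : SingularSimplex M p} (hσ : σ.IsSmooth I)
    {u : Fin (k + 1) → Fin (p + 1)} (hu : ¬Function.Injective u) (η : MForm I M F k) {t : Fin k → ℝ}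
    (ht : t ∈ unitCube k) : (σ.compose fun j ↦ stdSimplex.vertex (u j)).formIntegrand η t = 0 := by
  set ρ := σ.compose fun j ↦ stdSimplex.vertex (u j) with hρ
  set g : (Fin k → ℝ) → (Fin (p + 1) → ℝ) := vertexLabelCLM u ∘ Literature.Geometry.Manifold.cubeToSimplex k with hg
  have hgd : Differentiable ℝ g := (vertexLabelCLM u).differentiable.comp (differentiable_cubeToSimplex k)
  have hmaps : MapsTo g (unitCube k) (stdSimplex ℝ (Fin (p + 1))) := fun s hs ↦
    vertexLabelCLM_mem_stdSimplex u (cubeToSimplex_mem_stdSimplex hs)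
  have hut : UniqueMDiffWithinAt 𝓘(ℝ, Fin k → ℝ) (unitCube k) t := ((uniqueDiffOn_unitCube k) t ht).uniqueMDiffWithinAt
  -- the within-cube derivative of `ρ.cubeMap` is that of `σ̃ ∘ g`
  have heq : ρ.cubeMap =ᶠ[𝓝[unitCube k] t] (σ.bext ∘ g) :=
    eventually_nhdsWithin_of_forall fun s hs ↦ cubeMap_compose_vertex_eqOn σ u hs
  have hD : mfderivWithin 𝓘(ℝ, Fin k → ℝ) I ρ.cubeMap (unitCube k) t =
      (mfderivWithin 𝓘(ℝ, Fin (p + 1) → ℝ) I σ.bext (stdSimplex ℝ (Fin (p + 1))) (g t)).comp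
        (mfderivWithin 𝓘(ℝ, Fin k → ℝ) 𝓘(ℝ, Fin (p + 1) → ℝ) g (unitCube k) t) := by
    rw [heq.mfderivWithin_eq (cubeMap_compose_vertex_eqOn σ u ht)]
    refine mfderivWithin_comp t ?_ ?_ (fun s hs ↦ hmaps hs) hut
    · exact (hσ _ (hmaps ht)).mdifferentiableWithinAt (by simp)
    · exact (hgd t).mdifferentiableAt.mdifferentiableWithinAt
  -- the within-cube derivative of `g` is its Fréchet derivative `L_u ∘ Dc_k(t)`
  have hDg : ∀ v, mfderivWithin 𝓘(ℝ, Fin k → ℝ) 𝓘(ℝ, Fin (p + 1) → ℝ) g (unitCube k) t v =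
      vertexLabelCLM u (fderiv ℝ (Literature.Geometry.Manifold.cubeToSimplex k) t v) := fun v ↦ by
    rw [mfderivWithin_eq_fderivWithin, (hgd t).fderivWithin ((uniqueDiffOn_unitCube k) t ht), hg,
      ((vertexLabelCLM u).hasFDerivAt.comp t (differentiable_cubeToSimplex k t).hasFDerivAt).fderiv]
    rfl
  -- the `k` vectors fed to `η` are linearly dependent
  rw [formIntegrand_apply]
  have hfam : (fun i : Fin k ↦ mfderivWithin 𝓘(ℝ, Fin k → ℝ) I ρ.cubeMap (unitCube k) t (Pi.single i 1)) =
      fun i ↦ (mfderivWithin 𝓘(ℝ, Fin (p + 1) → ℝ) I σ.bext (stdSimplex ℝ (Fin (p + 1))) (g t))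
        (vertexLabelCLM u (fderiv ℝ (Literature.Geometry.Manifold.cubeToSimplex k) t (Pi.single i 1))) := by
    funext i
    rw [hD]
    exact (ContinuousLinearMap.comp_apply _ _ _).trans (congrArg _ (hDg _))
  have hdep : ¬LinearIndependent ℝ (fun i ↦ mfderivWithin 𝓘(ℝ, Fin k → ℝ) I ρ.cubeMap (unitCube k) t (Pi.single i 1)) := by
    rw [hfam]
    exact not_linearIndependent_of_mem_vertexDiffSpan hu
      ((mfderivWithin 𝓘(ℝ, Fin (p + 1) → ℝ) I σ.bext (stdSimplex ℝ (Fin (p + 1))) (g t)).toLinearMap)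
      (fun i ↦ vertexLabelCLM_mem_vertexDiffSpan u (sum_fderiv_cubeToSimplex_apply t _))
  exact AlternatingMap.map_linearDependent (η (ρ.cubeMap t)).toAlternatingMap _ hdep

/-- **The integral of a `k`-form over a degenerate affine reparametrisation of a smooth simplex
vanishes**: `∫_{σ ∘ [e_{u₀}, …, e_{u_k}]} η = 0` for `u` not injective (integration cochains kill
degenerate simplices; Eilenberg–Mac Lane 1953, Bredon (1993) VI §4). [cite: Bredon1993, VI §4] -/
theorem formIntegral_compose_vertex_eq_zero {σ : SingularSimplex M p} (hσ : σ.IsSmooth I)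
    {u : Fin (k + 1) → Fin (p + 1)} (hu : ¬Function.Injective u) (η : MForm I M F k) :
    (σ.compose fun j ↦ stdSimplex.vertex (u j)).formIntegral η = 0 :=
  setIntegral_eq_zero_of_forall_eq_zero fun _ ht ↦ formIntegrand_compose_vertex_eq_zero hσ hu η ht

end Literature.AlgebraicTopology.SingularHomology.SingularSimplex
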